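import Mathlib
import HarnessLib
import HarnessLib.Audit
import Summits.KontsevichZagierPeriods.Statement
import HarnessLib.Audit.Status.Attr

/-!
Route: GammaCornerAnomaly

DORMANT since 2026-08-23T18:58:35Z (reconciler: no traction for 6.2 d (last activity item-evidence-added at 2026-08-17T14:20:41Z); parked, not closed — `ledger route dormant route-KontsevichZagierPeriods-GammaCornerAnomaly --off` to rea) — unstaffed, not closed; items shared with open routes are served there. `ledger route dormant <id> --off` reactivates.

# Route GammaCornerAnomaly — Frobenius (MUM) constants log 16 | π² | ζ(3) of pencils over ℚ as typed
Conjecture-1 instances — Γ̂ predicts them, corner regularisation and exponent differentiation must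
produce them

It suffices to show X = LegendreMUMConstant ∧ LegendreLogWronskian ∧ MUMSectorComplete: (i) the
weight-1 and weight-2 layers of the MUM (maximal unipotent monodromy) transition of the Legendre
pencil y² = x(1−x)(1−λx) lie inside the rules, and (ii) the KZ calculus with exactly these Legendre
MUM pairs ADJOINED as extra relators already connects any two rational representations of equal
value — Conjecture 1 relative to the sector, carried by this route as its own conjecture-grade crux
(rev 3; the same closing debt every sector route of this summit owes, stated so that the sector
cruxes discharge the adjoined relators). Weight 1 (card K1, the Frobenius constant κ₁ = log 16 of
Bloch–Vlasenko / Roy–Vlasenko): at every rational fibre λ₀ ∈ (0,1) the 2-dimensional algebraic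
representation J(λ₀) = ∫∫_{(0,1)²} [(t(1−t)(1−λ₀xt))^{−1/2} − (t(1−t)(1−λ₀x²t))^{−1/2}] dt dx/(1−x)
(= (π/4)·analytic part of the log-Frobenius solution) is KZ-equivalent to the 2-dimensional
representation of −(π/2)K′(λ₀) + K(λ₀)(log 4 + ½ log(1/λ₀)) (K(m) = ∫₀¹dt/(2√(t(1−t)(1−mt))), K′(λ)
= K(1−λ)). Weight 2: the Wronskian of that flat combination against the invariant period K, with
Legendre's relation removed, is the conserved quantity D(λ) = (1−λ)K² − 2λ(1−λ)(J·K_λ − J_λ·K) =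
π²/4, filed as a 3-dimensional equivalence at every rational fibre. Realises card
gamma-class-is-a-corner-anomaly (spine): MUM transition constants as Conjecture-1 instances graded
by the Taylor expansion of Γ, the weight-3 rung represented by the Apéry–Beukers family (Apéry
constant κ(1) = ζ(3)/6; rational representations on both sides; support) and by the mirror-quintic
κ₃ = −200ζ(3) (informal item QuinticZetaThree); the mechanism claim "Γ̂-constants =
Dupont–Panzer–Pym stratified finite parts at the corner" is the informal item GammaIsLambda, whose
Legendre instance is computed here: log 16 = log 4 + log 4 from the two strata of the blown-up
corner (support LegendreCornerStrata).
Lean: `LegendreMUMConstant ∧ LegendreLogWronskian ∧ MUMSectorComplete`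

## Assembly
Pure logic, certified natively as the deciding theorem `closes : LegendreMUMConstant →
LegendreLogWronskian → MUMSectorComplete → KontsevichZagierPeriods` (rev 3): the two sector cruxes
put every adjoined MUM relator inside KZ.relations, so AddSubgroup.closure (↑relations ∪ MUM pairs)
≤ relations (closure_le over a three-way union) and the membership given by MUMSectorComplete is
KZ.Equivalent r r'. MUMSectorComplete is implied by the summit (subset_closure ∘ Or.inl, one line,
checked in the planner's Sketch.lean), so X is EQUIVALENT to the summit, not merely sufficient. The
weight-2 crux keeps its foreseen glued split LegendreLogWronskian ⇐ LogWronskianTransport (at λ₀ =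
0) + LogWronskianAnchor — both SUPPORT items sharing its `let LW : ℚ → Prop := …` family, the
implication definitional (Sketch.lean) — and LogWronskianTransport is conversely implied by
LegendreLogWronskian outright (its consequent ranges over all λ₁ ∈ (0,1)), so it is the intended
METHOD (Gauss–Manin transport with a rational certificate), not a separate obstruction: re-badged
support in rev 3. The route's informative work is ranks 2–3; its closing debt is MUMSectorComplete
(full Conjecture-1 strength off the sector, graded conjecture-grade in the dossier, staffed last).

Rationale: WHY THIS LINE. At a MUM point the matrix from the integral Betti periods to the Frobenius basis has
transcendental entries that are Taylor coefficients of Γ-products (Kerr arXiv:2008.03618 §6.7: for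
hypergeometric L, κ(s)⁻¹ = ΠΓ(s+aⱼ)/(Γ(s+1)Γ(aⱼ)); mirror quintic column (1, 0, 50ζ(2), −200ζ(3));
Legendre κ(s) = 16^sΓ(1+s)⁴/Γ(1+2s)², arXiv:2206.15181 (3)), and Bloch–Vlasenko prove these
Frobenius constants ARE Kontsevich–Zagier periods with an explicit second representation by
log-unfolded integrals ∫_Σ φ∧(dx/x)ⁿ∧dt/t (arXiv:1908.07501 Thm 30, Cor 31) — so every MUM
transition identity is an honest instance of Conjecture 1, and none has been posed to the rules.
Imported: mirror symmetry / Γ̂-integral structures (doi:10.1215/00127094-3476593,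
doi:10.1070/im8343, arXiv:0903.1463) as the PREDICTOR of the constants, motivic Mellin transforms
(BV, RV) as the source of uniform-in-exponent chains, log-corner regularisation
(DupontPanzerPym2026, hub route Deregularisation) and Gauss–Manin transport with rational
certificates (BostanLairezSalvy2013, hub route GaussManinCertificates) as the two engines that must
PRODUCE them inside the calculus. Working the Legendre case by hand splits the content sharply: the
Mellin-space form of κ(s) is ONE change of variables (t,x) ↦ (t/x,x) uniformly in s (RV's
computation = support LegendreMellinMoment), the Taylor-coefficient form of the Apéry constant is
Beukers' finite rational chain (supports AperyBeukersOne/All), and the weight-2 fibre identity is a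
conserved quantity tame at λ = 0 (crux 3, with its transport/anchor supports); only the weight-1
FIBRE identity needs an anchor for a non-conserved flat section at the corner, where πK′ and K log λ
diverge separately — that is the crux, and the corner's two strata (log 4 each) are the concrete
content of "Γ̂ = corner anomaly". No prior route touches MUM points: Deregularisation regularises
MZV corners, GaussManinCertificates transports Legendre's relation (weight 0) and anchors at a CM
fibre, TerasomaCovering/SelbergAMGM treat Γ-VALUES at rationals (type b1), not Γ-Taylor coefficients
(type b2). Off the sector the route owes what every sector route owes — Conjecture 1 for the
remaining rational pairs — and since rev 3 it carries that debt openly as the conjecture-grade crux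
MUMSectorComplete (relative form: relators = KZ moves ∪ Legendre MUM pairs), so that `closes`
decides the summit by name with the sector cruxes load-bearing.

RANKED CRUXES. #2 LegendreMUMConstant (crux) — card K1 — for every rational λ₀ ∈ (0,1), [ (0,1)²,
((t(1−t)(1−λ₀xt))^{−1/2} − (t(1−t)(1−λ₀x²t))^{−1/2})/(1−x) ] (value J(λ₀) = π Σ aₙλ₀ⁿ(H₂ₙ − Hₙ), aₙ
= (C(2n,n)/4ⁿ)²) is KZ-equivalent to [ (0,1)², −(2/(1+x²))·κ_{1−λ₀}(t) + (3/(1+3x) +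
(1−λ₀)/(2(λ₀+(1−λ₀)x)))·κ_{λ₀}(t) ], κ_m(t) = (t(1−t)(1−mt))^{−1/2}/2 (value −(π/2)K′(λ₀) +
K(λ₀)(log 4 + ½log(1/λ₀))); equivalently πK′ + K log λ − K log 16 + 2J = 0, i.e. φ₁ − 4log2·φ₀ ∝ K′
(RV p. 2; WhittakerWatson1927 §22.737). Verified to 1e−15 at λ₀ ∈ {1/5, 1/3, 1/2, 9/10}
(num/check1.py). [difficulty: XL] (why it might fail: all known proofs are q-expansion, ODE
uniqueness + the λ→0 asymptotic, or Mellin inversion of κ(s); a finite chain must anchor a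
NON-conserved flat section at the MUM corner, where πK′ and K log λ diverge separately
(concentration at scale s ~ λ).) [KontsevichZagier2001, WhittakerWatson1927, arXiv:2206.15181,
arXiv:1908.07501, arXiv:2008.03618, DupontPanzerPym2026]
#3 LegendreLogWronskian (crux) — weight-2 MUM identity (new): for every rational λ₀ ∈ (0,1), with
κ_m, κ⁽¹⁾_m(s) = ∂_mκ_m(s) = s(s(1−s)(1−ms))^{−1/2}/(4(1−ms)), j_λ(x,t) = the K1 integrand and ∂_λ
j_λ, the 3-dim rep [ (0,1)³, (1−λ₀)κ_{λ₀}(t)κ_{λ₀}(s) − 2λ₀(1−λ₀)( j_{λ₀}(x,t)κ⁽¹⁾_{λ₀}(s) −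
(∂_λj)_{λ₀}(x,t)κ_{λ₀}(s) ) ] (value D(λ₀) = (1−λ₀)K² − 2λ₀(1−λ₀)(J K_λ − J_λ K)) is KZ-equivalent
to [ (0,1)³, 4/((1+t²)(1+s²)) ] (value π²/4). D is the Wronskian λ(1−λ)(W̃K_λ − W̃_λK) of the K1
combination W̃ against K with the Legendre-relation part πλ(1−λ)(K′K_λ − K′_λK) = π²/4 removed; all
its pieces are invariant-cycle periods, continuous and L¹-tame at λ = 0 where D(0) = K(0)² = π²/4.
Verified to 1e−15 at λ₀ ∈ {0, 1/20, 1/5, 1/3, 1/2, 9/10}. [difficulty: L] (why it might fail: the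
only chain in view is λ-transport of the D-family from the MUM fibre (support
LogWronskianTransport); if ∂_λ of the D-integrand is not a divergence of semialgebraic fields whose
boundary terms on the faces t,s → 1 (κ ~ (1−t)^(−1/2)) converge and cancel, no finite chain is known
and the identity is as hard as K1.) [KontsevichZagier2001, MckeanMoll1999, BostanLairezSalvy2013,
arXiv:2008.03618, arXiv:2206.15181]
#9 MUMSectorComplete (crux, conjecture-grade; rank 9 = staffed after the sector cruxes) — Conjecture
1 RELATIVE to the Legendre MUM sector: for rational representations r, r′ (KZ §1.1 shape) of equal
value, [r] − [r′] ∈ AddSubgroup.closure(↑KZ.relations ∪ {Legendre MUM pairs}), the pairs being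
exactly the instances of LegendreMUMConstant (2-dim, rational λ ∈ (0,1)) and of the weight-2 family
LW λ (3-dim, rational λ ∈ (0,1)) as formal differences [ρ] − [ρ′]. Implied by the summit; with #2
and #3 it gives the summit (`closes`). It is full Conjecture-1 strength for everything outside the
sector and is claimed as such, not as a lemma in reach. (why it might fail: it is Conjecture 1 for
all remaining rational pairs — Grothendieck-period-conjecture strength (HuberMullerStach2017 Ch. 13,
Ayoub2015); false as soon as ONE rational identity needs a move outside rules 1)–3), e.g. route
Neg's triplication pair or a regularised-corner identity of another pencil.) [KontsevichZagier2001,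
HuberMullerStach2017, Ayoub2015, CressonViusos2022, arXiv:1908.07501]
Support (unranked): LogWronskianTransport (re-badged rev 3: Gauss–Manin transport LW λ₀ → LW λ₁ from
λ₀ ∈ [0,1), the METHOD for #3 — logically implied by #3, and with LogWronskianAnchor implying it;
plan: one Newton–Leibniz move in λ on (0,1)³ × [λ₀,λ₁], integrand additivity, a creative-telescoping
certificate ∂_λ(D-integrand) = ∂ₜC₁ + ∂ₛC₂ + ∂ₓC₃ with semialgebraic Cᵢ vanishing on the faces,
discharged by KZStokes-type box moves; risk: certificates are rational only off the branch divisor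
and the face terms carry (1−λs)^(−3/2)) [BostanLairezSalvy2013, Lairez2015, MckeanMoll1999];
LogWronskianAnchor (LW 0, i.e. K(0)² = (π/2)², one product change of variables; provable-now);
LegendreCornerStrata (the two log 4 strata of the blown-up corner; provable-now);
LegendreMellinMoment (RV's s-uniform chain; provable-now); DuplicationLogDerivative (π log 4;
provable-now); AperyBeukersOne (M) / AperyBeukersAll (L) (Beukers' rational chain, weight 3);
informal items QuinticZetaThree (rank 5) and GammaIsLambda (rank 6, waits for Deregularisation's
KZreg/Λ definition).

TWO-LAYER PLAN. Foreseen glued splits (k ≤ 3, depth 1), filed only when a crux closes or stalls with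
a census: LegendreMUMConstant ⇐ BetaPart (W̃ := πK′ + K log λ − K log16 + 2J is proportional to K:
the two conserved Wronskians Wr(W̃,K) = 0 — which is LegendreLogWronskian + Legendre's relation,
GaussManinCertificates.LegendreSector — and Wr(W̃,K′) = 0, reconstructed by the determinant identity
(π/4)·W̃ = K′·Wr(W̃,K) − K·Wr(W̃,K′)) → AlphaPart (the corner anchor: the stratified finite part of
πK′ + K log λ at λ = 0 is K(0)·(log 4 + log 4), LegendreCornerStrata, carried into the rules either
by Deregularisation's Λ (RegConservative on this genus-1 corner) or by StandardParts' SpArcClosure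
on the blown-up family) → LegendreMUMConstant; alternative child via the exponent direction:
MellinInversionInKZ (from the s-uniform chain LegendreMellinMoment and its log-derivatives to the
fibre) if a finite-chain inversion exists. LegendreLogWronskian ⇐ LogWronskianTransport (λ₀ = 0) →
LogWronskianAnchor → LegendreLogWronskian — already filed as support items over the shared `let LW`
family (glue definitional, Sketch.lean); a prover closing both closes #3 in three lines; the CM
anchor λ = ½ (K = K′) is the alternative base point. LogWronskianTransport ⇐ CertificateIdentity
(the explicit ∂_λ = div C on the open box, a 4-dim KZStokesBox instance) → BoundaryVanishing
(provers attach these with --supports; never items). MUMSectorComplete is NOT split here: its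
decompositions are the other sector routes of the summit (their kernels, adjoined sector by sector),
and any proved sector S′ upgrades it for free to "complete modulo MUM ∪ S′".

KILL CRITERIA. ¬LegendreMUMConstant (an additive invariant of the four move sets separating the two
sides at one rational λ₀) closes the route `refuted:LegendreMUMConstant` and — both sides being
algebraic representations of one number — refutes the summit modulo KZ.exists_isRational_equivalent:
hand the witness to route Neg as the first weight-1 corner witness (type b2). ¬LegendreLogWronskian
likewise. ¬MUMSectorComplete (a rational pair not connected even with the MUM relators adjoined)
refutes the summit outright (MUMSectorComplete is implied by it): the route then closes
`refuted:MUMSectorComplete` having banked whatever sector items are proved, and the witness goes to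
Neg. A support LogWronskianTransport shown impossible as a METHOD (no rational certificate with
convergent face terms) is not a refutation of #3: pivot the weight-2 layer to the CM anchor λ = ½ (K
= K′) shared with GaussManinCertificates.LegendreSector, or to a direct fibrewise chain.
AperyBeukersOne refuted would refute the summit outright with RATIONAL 3-dim representations (the
cleanest possible witness) — and kill Beukers-chain folklore; extremely unlikely, hence support. If
GammaIsLambda's general form fails (a MUM corner whose stratified finite part is not the Γ̂/κ⁻¹
column in any tangential normalisation) the MECHANISM dies and the route shrinks to its instances
(pivot: thesis := instances + MUMSectorComplete only). LegendreMUMConstant proved through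
StandardParts.SpArcClosure or Deregularisation.RegConservative makes this route their calibration
(supersede the mechanism, keep the items).

NOT DECOMPOSED YET. The α/β split of K1 (above) — not filed until a prover's census says which half
stalls; the certificate identity behind LogWronskianTransport (a prover finds C₁, C₂, C₃ by creative
telescoping and attaches it with --supports); real-algebraic (not only rational) fibres λ₀; the
log-derivative (E-lemma) instances of LegendreMellinMoment at s = 1 (3-dim, logs unfolded) —
provable the same way, left to provers as --supports lemmas; the t₀ ≠ 0 fibre form of the Apéry
identity (needs semialgebraic representations of the K3 periods A(t₀): torus cycles, 4-dim after
rational parametrisation) and the log-solutions of the Apéry operator (κ₂ = −2ζ(2), κ₃ = 17ζ(3)/6);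
the mirror-quintic κ₃ = −200ζ(3) fibre identity (informal item QuinticZetaThree: ≤ 7-dim reps,
digamma constants at k/5 must cancel); the mechanism statement GammaIsLambda (informal, waits for
Deregularisation's KZreg/Λ definition); weight-4+ constants of non-hypergeometric elliptic pencils,
which are NOT MZVs (arXiv:2206.15181 Table 2, starred) and are excluded from the Γ̂ prediction (only
κ₀…κ_n, n = fibre dimension, are LMHS periods of M); and MUMSectorComplete itself, whose natural
pieces are the OTHER sector routes' kernels (no split inside this route).

CHEAPEST FALSIFIER. Lookup: an integral-calculus proof (algebraic substitutions + Stokes on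
absolutely convergent integrals only, no limit, no series, no ODE uniqueness) of K′ = (2/π)K
log(4/k) − … or of J(λ) = −(π/2)K′ + K(log 4 + ½log(1/λ)) would make rank 2 `known` and the sector a
transcription job. Searched (2026-08-15): arXiv:2206.15181 (Fubini + t = xu gives only the Mellin
transform; the fibre statement is quoted from the classical literature, their [10,(9)]),
WhittakerWatson1927 §22.737 (q-series), AndrewsAskeyRoy1999 §2.3/§3.2 (connection formulae by
ODE/Barnes), hub Theses (none) — no hit. Numerics already run (num/check1.py, gen/verify_strings.py
on the literal Lean integrand strings): K1 and D = π²/4 to 1e−15, strata log 4 + log 4, Beukers n =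
1, 2 to 1e−7, bₙ closed form = recurrence. Organising-claim falsifier (card K4, sharpened): a
Frobenius constant κ_j with j ≤ fibre dimension of a MUM pencil over ℚ that is provably not in the
Γ̂/MZV span — RV prove κ₂ ∈ ℚπ² for all six Beauville families (Thm 4), consistent; their starred
κ₄'s are beyond the Γ̂ range and do not count. For MUMSectorComplete the cheapest falsifier is route
Neg's deciding pair (NegTriplicationNotAccessible ∧ TriplicationValueEq): if Neg closes, the summit
and with it MUMSectorComplete are false.

NUMBERS. Legendre: κ(s) = 16^sΓ(1+s)⁴/Γ(1+2s)² (arXiv:2206.15181 (3)), κ₁ = 4 log 2, κ₂ = 8log²2 −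
π²/3; K(0) = π/2; Wr: λ(1−λ)(K′K_λ − K′_λK) = π/4 (Legendre's relation in these coordinates, checked
1e−15); J(1/3) = 0.169088893705481, J(1/2) = 0.300492895089163; D(λ) = π²/4 = 2.467401100272340 at λ
∈ {0, .05, .2, 1/3, .5, .9}. Apéry: aₙ = 1, 5, 73, 1445, 33001; bₙ = 0, 6, 351/4, 62531/36,
11424695/288; L A = 0, L B = 6t; ∫P/Q² = 0.02056903 = 2(5ζ(3)−6), ∫P²/Q³ = 3.0786e−4 = 2(73ζ(3) −
351/4); conifold radius (√2−1)⁴ = 0.0294; κ₂ = −2ζ(2), κ₃ = 17ζ(3)/6, κ(1) = ζ(3)/6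
(arXiv:1908.07501 Rem 32, doi:10.1070/im8343). Quintic: LMHS column (1, −5log5, 10ζ(2) +
(25/2)log²5, −40ζ(3) − 50 log5 ζ(2) − (125/6)log³5) → (1, 0, 50ζ(2), −200ζ(3)) after t ↦ t/5⁵ and
the integral basis (arXiv:2008.03618 §6.7). Items after rev 3: 13 (3 cruxes — LegendreMUMConstant,
LegendreLogWronskian, MUMSectorComplete —, 7 typed supports, 2 informal items, 1 assembly); `closes`
has exactly the three cruxes as hypotheses.

DEFINITION REQUESTS. None new. GammaIsLambda waits for route Deregularisation's definition request
(KZreg, Λ = stratified finite part with tangential data; DupontPanzerPym2026 Thm/Def 1.5, Prop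
7.15). Convenient later, not requested: `KZ.frobeniusRep` packaging the analytic parts g_k(z₀) of a
hypergeometric Frobenius basis as rational representations with unfolded logs.

Novelty: Searches (2026-08-15): `lit search "Frobenius constants monodromy Gamma functions Picard-Fuchs
maximal unipotent periods Bloch Vlasenko"`
(local 1 + crossref 12: BV 2021, Kerr 2022, Roy–Vlasenko 2023, Garbagnati–van Geemen,
Lian–Todorov–Yau); `lit galaxy search "Frobenius constants"
--star all` (3 rows: pdf arXiv:2206.15181 read pp. 1–7, 10–12; two crypto false hits); `lit galaxy
search "Apery limit" | "period conjecture of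
Kontsevich" --star all` (0 relevant); `lit read arXiv:2008.03618` (§§4–8 read: T5.1, T5.2, T6.1,
§6.7, E8.1) and `arXiv:1908.07501` (Thm 30, Cor
31, Rem 32, Prop 47 read); crossref title checks for doi:10.1070/im8343,
doi:10.1215/00127094-3476593; hub grep of all 62 KZ Theses for
MUM|unipotent|Frobenius basis|Gamma class|quintic|log 16|Iritani|Candelas (0 routes); the card's
searches (hub Ideas grep, lit --hybrid on Γ̂/ζ(3)/
quintic, lit frontier, galaxy "Kontsevich-Zagier"); `ledger negatives` (gate unreachable at filing;
Theorems/*Refutation* read: NoriTransfer only).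
Nearest prior art found: arXiv:1908.07501 (Bloch–Vlasenko, Cor 31: Frobenius constants of
Picard–Fuchs operators are KZ periods, second
representation by log-unfolded integrals; Rem 32 Apéry); arXiv:2206.15181 =
doi:10.1093/qmath/haad034 (Roy–Vlasenko: Legendre κ(s) by one
Fubini + substitution; κ₂ ∈ ℚπ² for Beauville families, higher constants as regularised iterated
integrals à la Brown); arXiv:2008.03618 (Kerr:
LMHS = Γ-Taylor column, quintic −200ζ(3)); doi:10.1070/im8343, doi:10.1215/00  [refs: 10.1070/im8343, 10.1215/00127094-3476593, 10.1093/qmath/haad034, 10.1112/blms/11.3.268, 2206.15181, 2008.03618, 1908.07501, 0903.1463, doi:10.1070/im8343, doi:10.1215/00127094-3476593, doi:10.1093/qmath/haad034, doi:10.1112/blms/11.3.268, DupontPanzerPym2026]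

Barriers (technique_class: corner-regularisation, exponent-differentiation, transport): - technique_class: corner-regularisation, exponent-differentiation, transport
- Literature.Barriers.KontsevichZagierPeriods.noSemialgebraicPrimitive_inv_sub_two: evaded in
LegendreMellinMoment, DuplicationLogDerivative, AperyBeukersOne/All and LegendreCornerStrata (only
changes of variables, additivity, and Newton–Leibniz with polynomial×rational primitives; logarithms
are never primitives but unfolded fibre coordinates ∫du/u riding along the maps); evaded in
LogWronskianTransport because the λ-primitive is the integrand family itself and the certificates
are rational (BostanLairezSalvy2013); CONFRONTED in LegendreMUMConstant, whose corner anchor needs Λ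
(Deregularisation's RegConservative) or divergence trading on a blow-up (StandardParts) — named
load-bearing, not assumed away.
- Literature.Barriers.KontsevichZagierPeriods.kzConjecture_implies_oddZetaAlgIndep: not an obstacle
— the items are identities INVOLVING ζ(3) (Apéry, quintic), never independence statements; it is the
reason the weight-3 rung matters: odd zeta values enter non-Tate period rings exactly through MUM
constants, so a Neg witness of this type must beat Beukers' rational chain (it cannot: AperyBeukers
is finite) or the corner anchor.
- Literature.Barriers.KontsevichZagierPeriods.kzConjecture_implies_twoPiI_log_algIndep: consistent —
log 16, log λ₀ and π occur with algebraic moduli in proven identities; nothing here forces a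
relation between 2πi and logs.
- Literature.Barriers.KontsevichZagierPeriods.kzConj

History (route lifecycle, newest last):
- 2026-08-15T13:59:24Z · rev 1: restated Assembly (stmt-KontsevichZagierPeriods-8985) — glue-first: add SummitOffMUMSector, restate Assembly to end in KontsevichZagierPeriods, file theorem closes (planner-plancard-KontsevichZagierPeriods-Kont-26589d6c-0)
- 2026-08-15T16:37:15Z · rev 2: restated Assembly (stmt-KontsevichZagierPeriods-9513) — route-repair (cone, rrepair g2): re-route the off-sector item around the open registrations — add MUMSectorComplete (relative completeness modulo the Legendre M (planner-rrepair-KontsevichZagierPeriods-GammaC-76103480-g2-0)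
- 2026-08-15T16:37:15Z · rev 2: dropped SummitOffMUMSector — route-repair (cone, rrepair g2): re-route the off-sector item around the open registrations — add MUMSectorComplete (relative completeness modulo the Legendre M (planner-rrepair-KontsevichZagierPeriods-GammaC-76103480-g2-0)
- 2026-08-16T02:18:25Z · AUTO-CRUX: 1 conjecture-grade item(s) promoted to crux (MUMSectorComplete) — refuter vetting / tiering apply (operator:999:1362873)
- 2026-08-16T02:56:49Z · rev 3: restated MUMSectorComplete (stmt-KontsevichZagierPeriods-11010), Assembly (stmt-KontsevichZagierPeriods-11009) — route-repair (badge, rbadge g1): clear route.partial-claim — the off-sector item MUMSectorComplete is now CLAIMED as the route's conjecture-grade crux (restated (planner-rbadge-KontsevichZagierPeriods-GammaCo-76103480-0)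
- 2026-08-16T04:03:56Z · rev 6: dropped stmt-KontsevichZagierPeriods-11010 — route-choice gen 3 (unit rchoice-KontsevichZagierPeriods-GammaC-a17bf7a1-g3; operator hold partial-claim 02:41:15Z): OPTION (a) stands — the off-sector remainde (planner-rchoice-KontsevichZagierPeriods-GammaC-a17bf7a1-g3-0)
- 2026-08-23T18:58:35Z · DORMANT — reconciler: no traction for 6.2 d (last activity item-evidence-added at 2026-08-17T14:20:41Z); parked, not closed — `ledger route dormant route-KontsevichZagier (operator:999:469152)

sub-problem: KontsevichZagierPeriods · status: dormant · opened planner-plancard-KontsevichZagierPeriods-Kont-26589d6c-0 2026-08-15T13:45:35Z · rev 9 · ledger route-KontsevichZagierPeriods-GammaCornerAnomaly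
GENERATED by the gate from the ledger (D-0016/17). Provers cite these decls: `theorem foo : Summit.KontsevichZagierPeriods.KontsevichZagierPeriods.Theses.GammaCornerAnomaly.<Decl> := …` in Summits/KontsevichZagierPeriods/KontsevichZagierPeriods/Theorems/<Name>.lean.
-/

namespace Summit.KontsevichZagierPeriods.KontsevichZagierPeriods.Theses.GammaCornerAnomaly

open scoped BigOperators Topology Manifold Classical MeasureTheory ProbabilityTheory Matrix InnerProductSpace ComplexConjugate ContinuousMap
open Filter Set Function TopologicalSpace MeasureTheory

attribute [summit_statement] _root_.KontsevichZagierPeriods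

open Literature Periods

/-- item stmt-KontsevichZagierPeriods-8976 · crux · rank 2 · open · by planner
why it might fail: all known proofs are q-expansion, ODE uniqueness + the λ→0 asymptotic, or Mellin inversion of κ(s); a finite chain must anchor a NON-conserved flat section at the MUM corner, where πK′ and K log λ diverge separately (concentration at scale s ~ λ).
sources: KontsevichZagier2001, WhittakerWatson1927, arXiv:2206.15181, arXiv:1908.07501, arXiv:2008.03618, DupontPanzerPym2026
[crux] card K1 — for every rational λ₀ ∈ (0,1), [ (0,1)², ((t(1−t)(1−λ₀xt))^{−1/2} −
(t(1−t)(1−λ₀x²t))^{−1/2})/(1−x) ] (value J(λ₀) = π Σ aₙλ₀ⁿ(H₂ₙ − Hₙ), aₙ = (C(2n,n)/4ⁿ)²) is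
KZ-equivalent to [ (0,1)², −(2/(1+x²))·κ_{1−λ₀}(t) + (3/(1+3x) + (1−λ₀)/(2(λ₀+(1−λ₀)x)))·κ_{λ₀}(t)
], κ_m(t) = (t(1−t)(1−mt))^{−1/2}/2 (value −(π/2)K′(λ₀) + K(λ₀)(log 4 + ½log(1/λ₀))); equivalently
πK′ + K log λ − K log 16 + 2J = 0, i.e. φ₁ − 4log2·φ₀ ∝ K′ (RV p. 2; WhittakerWatson1927 §22.737).
Verified to 1e−15 at λ₀ ∈ {1/5, 1/3, 1/2, 9/10} (num/check1.py). [difficulty: XL] -/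
@[route_item "route-KontsevichZagierPeriods-GammaCornerAnomaly", crux]
def LegendreMUMConstant : Prop :=
  ∀ l : ℚ, 0 < l → l < 1 → ∀ (r r' : Literature.NumberTheory.Transcendental.KZ.IntegralRep 2), r.domain = {q | ∀ i, q i ∈ Set.Ioo (0:ℝ) 1} → Set.EqOn r.integrand (fun q => (((q 1 * (1 - q 1) * (1 - (l:ℝ) * q 0 * q 1)) ^ (-(1:ℝ)/2) - (q 1 * (1 - q 1) * (1 - (l:ℝ) * q 0 ^ 2 * q 1)) ^ (-(1:ℝ)/2)) / (1 - q 0))) r.domain → r'.domain = {q | ∀ i, q i ∈ Set.Ioo (0:ℝ) 1} → Set.EqOn r'.integrand (fun q => (-(2 / (1 + q 0 ^ 2)) * ((q 1 * (1 - q 1) * (1 - (1 - (l:ℝ)) * q 1)) ^ (-(1:ℝ)/2) / 2) + (3 / (1 + 3 * q 0) + (1 - (l:ℝ)) / (2 * ((l:ℝ) + (1 - (l:ℝ)) * q 0))) * ((q 1 * (1 - q 1) * (1 - (l:ℝ) * q 1)) ^ (-(1:ℝ)/2) / 2))) r'.domain → Literature.NumberTheory.Transcendental.KZ.Equivalent r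 r'

/-- item stmt-KontsevichZagierPeriods-8977 · crux · rank 3 · open · by planner
why it might fail: Only chain in view: λ-transport of the D-family from the MUM fibre (support LogWronskianTransport); if ∂_λ of the D-integrand is not a divergence of semialgebraic fields whose face terms (κ ~ (1−t)^(−1/2), κ⁽¹⁾ ~ (1−λs)^(−3/2)) converge and cancel, no finite chain is known: as hard as K1.
sources: KontsevichZagier2001, MckeanMoll1999, BostanLairezSalvy2013, Lairez2015, arXiv:2008.03618, arXiv:2206.15181
[crux] weight-2 MUM identity (new): for every rational λ₀ ∈ (0,1), with κ_m, κ⁽¹⁾_m(s) = ∂_mκ_m(s) =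
s(s(1−s)(1−ms))^{−1/2}/(4(1−ms)), j_λ(x,t) = the K1 integrand and ∂_λ j_λ, the 3-dim rep [ (0,1)³,
(1−λ₀)κ_{λ₀}(t)κ_{λ₀}(s) − 2λ₀(1−λ₀)( j_{λ₀}(x,t)κ⁽¹⁾_{λ₀}(s) − (∂_λj)_{λ₀}(x,t)κ_{λ₀}(s) ) ] (value
D(λ₀) = (1−λ₀)K² − 2λ₀(1−λ₀)(J K_λ − J_λ K)) is KZ-equivalent to [ (0,1)³, 4/((1+t²)(1+s²)) ] (value
π²/4). D is the Wronskian λ(1−λ)(W̃K_λ − W̃_λK) of the K1 combination W̃ against K with the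
Legendre-relation part πλ(1−λ)(K′K_λ − K′_λK) = π²/4 removed; all its pieces are invariant-cycle
periods, continuous and L¹-tame at λ = 0 where D(0) = K(0)² = π²/4. Verified to 1e−15 at λ₀ ∈ {0,
1/20, 1/5, 1/3, 1/2, 9/10}. [deps: LogWronskianTransport, LogWronskianAnchor] [difficulty: L] -/
@[route_item "route-KontsevichZagierPeriods-GammaCornerAnomaly", crux]
def LegendreLogWronskian : Prop :=
  let LW : ℚ → Prop := fun l => ∀ (r r' : Literature.NumberTheory.Transcendental.KZ.IntegralRep 3), r.domain = {p | ∀ i, p i ∈ Set.Ioo (0:ℝ) 1} → Set.EqOn r.integrand (fun p => ((1 - (l:ℝ)) * ((p 1 * (1 - p 1) * (1 - (l:ℝ) * p 1)) ^ (-(1:ℝ)/2) / 2) * ((p 2 * (1 - p 2) * (1 - (l:ℝ) * p 2)) ^ (-(1:ℝ)/2) / 2) - 2 * (l:ℝ) * (1 - (l:ℝ)) * ((((p 1 * (1 - p 1) * (1 - (l:ℝ) * p 0 * p 1)) ^ (-(1:ℝ)/2) - (p 1 * (1 - p 1) * (1 - (l:ℝ) * p 0 ^ 2 * p 1)) ^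 (-(1:ℝ)/2)) / (1 - p 0)) * (p 2 * (p 2 * (1 - p 2) * (1 - (l:ℝ) * p 2)) ^ (-(1:ℝ)/2) / (4 * (1 - (l:ℝ) * p 2))) - ((p 0 * p 1 * (p 1 * (1 - p 1) * (1 - (l:ℝ) * p 0 * p 1)) ^ (-(1:ℝ)/2) / (2 * (1 - (l:ℝ) * p 0 * p 1)) - p 0 ^ 2 * p 1 * (p 1 * (1 - p 1) * (1 - (l:ℝ) * p 0 ^ 2 * p 1)) ^ (-(1:ℝ)/2) / (2 * (1 - (l:ℝ) * p 0 ^ 2 * p 1))) / (1 - p 0)) * ((p 2 * (1 - p 2) * (1 - (l:ℝ) * p 2)) ^ (-(1:ℝ)/2) / 2)))) r.domain → r'.domain = {p | ∀ i, p i ∈ Set.Ioo (0:ℝ) 1} → Set.EqOn r'.integrand (fun p => 4 / ((1 + p 1 ^ 2) * (1 + p 2 ^ 2))) r'.domain → Literature.NumberTheory.Transcendental.KZ.Equivalent r r'; ∀ l : ℚ, 0 < l → l < 1 → LW l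

-- earlier MUMSectorComplete (stmt-KontsevichZagierPeriods-11010, replaced 2026-08-16T02:56:49Z -> stmt-KontsevichZagierPeriods-14089): retired by None — ∀ ⦃n m : ℕ⦄ (r : Literature.NumberTheory.Transcendental.KZ.IntegralRep n) (r' : Literature.NumberTheory.Transcendental.KZ.IntegralRep m), r.IsRational → r'.IsRational → r.value = r'.value → Literature.NumberTheory.Transcendental.KZ.of r - Literature
/-- item stmt-KontsevichZagierPeriods-14089 · crux · rank 9 · open · by planner
why it might fail: It is Conjecture 1 for every rational pair outside the sector (GPC strength: HuberMullerStach2017 Ch. 13, Ayoub2015); false as soon as ONE rational identity needs a move outside rules 1)–3) plus the MUM relators — e.g. route Neg's triplication pair, or a regularised corner of another pencil.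
sources: KontsevichZagier2001, HuberMullerStach2017, Ayoub2015, CressonViusos2022, arXiv:1908.07501
[crux · conjecture-grade · claimed by the route] CONJECTURE 1 RELATIVE TO THE LEGENDRE MUM SECTOR
(rev-3 restatement of the rev-2 item in closure-of-union form). For rational representations r, r′
(KZ §1.1 shape) with equal value, [r] − [r′] ∈ AddSubgroup.closure(↑KZ.relations ∪ MUM pairs), the
MUM pairs being exactly the instances of LegendreMUMConstant (2-dim pairs, rational λ ∈ (0,1)) and
of the weight-2 Wronskian family LW λ of LegendreLogWronskian (3-dim pairs, rational λ ∈ (0,1)) as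
formal differences [ρ] − [ρ′]: the KZ calculus ENLARGED by the Legendre MUM equivalences already
connects any two rational representations of equal value. Implied by the summit (subset_closure ∘
Or.inl, one line, planner's Sketch.lean) and, together with LegendreMUMConstant and
LegendreLogWronskian, giving it — the deciding theorem `closes` (closure_le over the three-way
union). It has full Conjecture-1 strength for every pair outside the sector and the route CLAIMS it
as such: its closing debt, shared in substance with every sector route of the summit (any proved
sector S′ upgrades it for free to completeness modulo MUM ∪ S′); it is ranked last, after the
informative sector cruxes. [difficulty: X -/
@[route_item "route-KontsevichZagierPeriods-GammaCornerAnomaly", crux]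
def MUMSectorComplete : Prop :=
  ∀ ⦃n m : ℕ⦄ (r : Literature.NumberTheory.Transcendental.KZ.IntegralRep n) (r' : Literature.NumberTheory.Transcendental.KZ.IntegralRep m), r.IsRational → r'.IsRational → r.value = r'.value → Literature.NumberTheory.Transcendental.KZ.of r - Literature.NumberTheory.Transcendental.KZ.of r' ∈ AddSubgroup.closure ((Literature.NumberTheory.Transcendental.KZ.relations : Set Literature.NumberTheory.Transcendental.KZ.FormalRep) ∪ ({d : Literature.NumberTheory.Transcendental.KZ.FormalRep | ∃ (l : ℚ) (ρ ρ' : Literature.NumberTheory.Transcendental.KZ.IntegralRep 2), 0 < l ∧ l < 1 ∧ ρ.domain = {q | ∀ i, q i ∈ Set.Ioo (0:ℝ) 1} ∧ Set.EqOn ρ.integrand (fun q => (((q 1 * (1 - q 1) * (1 - (l:ℝ) * q 0 * q 1)) ^ (-(1:ℝ)/2) - (q 1 * (1 - q 1) * (1 - (l:ℝ) * q 0 ^ 2 * q 1)) ^ (-(1:ℝ)/2)) / (1 - q 0))) ρ.domain ∧ ρ'.domain = {q | ∀ i, q i ∈ Set.Ioo (0:ℝ) 1} ∧ Set.EqOn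 ρ'.integrand (fun q => (-(2 / (1 + q 0 ^ 2)) * ((q 1 * (1 - q 1) * (1 - (1 - (l:ℝ)) * q 1)) ^ (-(1:ℝ)/2) / 2) + (3 / (1 + 3 * q 0) + (1 - (l:ℝ)) / (2 * ((l:ℝ) + (1 - (l:ℝ)) * q 0))) * ((q 1 * (1 - q 1) * (1 - (l:ℝ) * q 1)) ^ (-(1:ℝ)/2) / 2))) ρ'.domain ∧ d = Literature.NumberTheory.Transcendental.KZ.of ρ - Literature.NumberTheory.Transcendental.KZ.of ρ'} ∪ {d : Literature.NumberTheory.Transcendental.KZ.FormalRep | ∃ (l : ℚ) (ρ ρ' : Literature.NumberTheory.Transcendental.KZ.IntegralRep 3), 0 < l ∧ l < 1 ∧ ρ.domain = {p | ∀ i, p i ∈ Set.Ioo (0:ℝ) 1} ∧ Set.EqOn ρ.integrand (fun p => ((1 - (l:ℝ)) * ((p 1 * (1 - p 1) * (1 - (l:ℝ) * p 1)) ^ (-(1:ℝ)/2) / 2) * ((p 2 * (1 - p 2) * (1 - (l:ℝ) * p 2)) ^ (-(1:ℝ)/2) / 2) - 2 * (l:ℝ) * (1 - (l:ℝ)) *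 ((((p 1 * (1 - p 1) * (1 - (l:ℝ) * p 0 * p 1)) ^ (-(1:ℝ)/2) - (p 1 * (1 - p 1) * (1 - (l:ℝ) * p 0 ^ 2 * p 1)) ^ (-(1:ℝ)/2)) / (1 - p 0)) * (p 2 * (p 2 * (1 - p 2) * (1 - (l:ℝ) * p 2)) ^ (-(1:ℝ)/2) / (4 * (1 - (l:ℝ) * p 2))) - ((p 0 * p 1 * (p 1 * (1 - p 1) * (1 - (l:ℝ) * p 0 * p 1)) ^ (-(1:ℝ)/2) / (2 * (1 - (l:ℝ) * p 0 * p 1)) - p 0 ^ 2 * p 1 * (p 1 * (1 - p 1) * (1 - (l:ℝ) * p 0 ^ 2 * p 1)) ^ (-(1:ℝ)/2) / (2 * (1 - (l:ℝ) * p 0 ^ 2 * p 1))) / (1 - p 0)) * ((p 2 * (1 - p 2) * (1 - (l:ℝ) * p 2)) ^ (-(1:ℝ)/2) / 2)))) ρ.domain ∧ ρ'.domain = {p | ∀ i, p i ∈ Set.Ioo (0:ℝ) 1} ∧ Set.EqOn ρ'.integrand (fun p => 4 / ((1 + p 1 ^ 2) * (1 + p 2 ^ 2))) ρ'.domain ∧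 d = Literature.NumberTheory.Transcendental.KZ.of ρ - Literature.NumberTheory.Transcendental.KZ.of ρ'}))

/-- item stmt-KontsevichZagierPeriods-8978 · support · rank 4 · open · by planner
why it might fail: certificates from creative telescoping are rational only off the branch divisor; here boundary terms live on faces where κ_λ ~ (1−t)^(−1/2)(1−λt)^(−1/2) and κ⁽¹⁾ carries (1−λs)^(−3/2) — they must converge and cancel exactly, for every λ up to the corner λ₀ = 0.
sources: BostanLairezSalvy2013, Lairez2015, MckeanMoll1999, KontsevichZagier2001
[crux] Gauss–Manin transport of the conserved quantity D, including FROM the MUM fibre: for rational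
λ₀ ∈ [0,1) and λ₁ ∈ (0,1), the weight-2 equivalence at λ₀ implies it at λ₁. Plan: one Newton–Leibniz
move in λ on the band (0,1)³ × [λ₀,λ₁] (primitive = the D-integrand family itself, absolutely
integrable derivative since every piece is an invariant-cycle kernel), integrand additivity, then a
creative-telescoping certificate ∂_λ(D-integrand) = ∂ₜC₁ + ∂ₛC₂ + ∂ₓC₃ with semialgebraic Cᵢ
vanishing on the faces (the x-direction boundary terms are the lower-dimensional K-type reps that
cancel), discharged by KZStokes-type box moves (GaussManinCertificates.KZStokesBox). [difficulty: L] -/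
@[route_item "route-KontsevichZagierPeriods-GammaCornerAnomaly"]
def LogWronskianTransport : Prop :=
  let LW : ℚ → Prop := fun l => ∀ (r r' : Literature.NumberTheory.Transcendental.KZ.IntegralRep 3), r.domain = {p | ∀ i, p i ∈ Set.Ioo (0:ℝ) 1} → Set.EqOn r.integrand (fun p => ((1 - (l:ℝ)) * ((p 1 * (1 - p 1) * (1 - (l:ℝ) * p 1)) ^ (-(1:ℝ)/2) / 2) * ((p 2 * (1 - p 2) * (1 - (l:ℝ) * p 2)) ^ (-(1:ℝ)/2) / 2) - 2 * (l:ℝ) * (1 - (l:ℝ)) * ((((p 1 * (1 - p 1) * (1 - (l:ℝ) * p 0 * p 1)) ^ (-(1:ℝ)/2) - (p 1 * (1 - p 1) * (1 - (l:ℝ) * p 0 ^ 2 * p 1)) ^ (-(1:ℝ)/2)) / (1 - p 0)) * (p 2 * (p 2 * (1 - p 2) * (1 - (l:ℝ) * p 2)) ^ (-(1:ℝ)/2) / (4 * (1 - (l:ℝ) * p 2))) - ((p 0 * p 1 * (p 1 * (1 - p 1) * (1 - (l:ℝ) * p 0 * p 1)) ^ (-(1:ℝ)/2) / (2 * (1 -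 (l:ℝ) * p 0 * p 1)) - p 0 ^ 2 * p 1 * (p 1 * (1 - p 1) * (1 - (l:ℝ) * p 0 ^ 2 * p 1)) ^ (-(1:ℝ)/2) / (2 * (1 - (l:ℝ) * p 0 ^ 2 * p 1))) / (1 - p 0)) * ((p 2 * (1 - p 2) * (1 - (l:ℝ) * p 2)) ^ (-(1:ℝ)/2) / 2)))) r.domain → r'.domain = {p | ∀ i, p i ∈ Set.Ioo (0:ℝ) 1} → Set.EqOn r'.integrand (fun p => 4 / ((1 + p 1 ^ 2) * (1 + p 2 ^ 2))) r'.domain → Literature.NumberTheory.Transcendental.KZ.Equivalent r r'; ∀ l₀ l₁ : ℚ, 0 ≤ l₀ → l₀ < 1 → 0 < l₁ → l₁ < 1 → LW l₀ → LW l₁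

-- item stmt-KontsevichZagierPeriods-9648 · support · rank 5 · open · by planner — informal only, no Lean statement yet:
--   [crux] (card K2; informal until the ≤7-dim representations are written) The weight-3 Frobenius
--   constant of the mirror quintic at an algebraic fibre. For rational z₀ with 0 < z₀ < 5⁻⁵ (MUM
--   coordinate z = (5ψ)⁻⁵ of the Dwork pencil x₁⁵+…+x₅⁵ − 5ψx₁x₂x₃x₄x₅ = 0), the period of the
--   holomorphic 3-form over the conifold-vanishing 3-sphere (a semialgebraic 3-cycle in the real locus;
--   CdGP's second period), written as real 3-dimensional algebraic representations, is KZ-equivalent to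
--   the ℤ-combination of products [log^k(z₀) unfolded as iterated ∫dv/v] × [g_j(z₀)] dictated by the
--   LMHS column of the quint

-- item stmt-KontsevichZagierPeriods-9641 · support · rank 6 · open · by planner — informal only, no Lean statement yet:
--   [crux] (card K3, the MECHANISM; informal until route Deregularisation's definition request KZreg / Λ
--   = Dupont–Panzer–Pym stratified finite part with rational tangential data lands) "The Gamma class is
--   a corner anomaly": at a MUM corner z = 0 of a pencil over ℚ whose large-complex-structure fibre is a
--   normal-crossing arrangement (after semistable reduction), the stratified finite part Λ (tangential
--   base point ∂/∂z) of the log-divergent Betti period representations equals the combination of the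
--   Frobenius-basis analytic parts dictated by the Γ-Taylor column κ(s)⁻¹ = ΠⱼΓ(s+aⱼ)/(Γ(s+1)Γ(aⱼ))
--   (Kerr

/-- item stmt-KontsevichZagierPeriods-8979 · support · rank 9 · open · by planner
sources: KontsevichZagier2001, AndrewsAskeyRoy1999
[support] the weight-2 identity AT the MUM fibre λ₀ = 0 (literal instance of the same family): [
(0,1)³, κ₀(t)κ₀(s) − 0 ] ~ [ (0,1)³, 4/((1+t²)(1+s²)) ], i.e. K(0)² = (π/2)²: one product change of
variables (t,s) ↦ (u,v) with t = u²/(1+u²)-type rational maps (dummy x rides along) after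
simplifying the zero factor. Exercises changeOfVariablesRel in dimension 3. [difficulty:
provable-now] -/
@[route_item "route-KontsevichZagierPeriods-GammaCornerAnomaly"]
def LogWronskianAnchor : Prop :=
  let LW : ℚ → Prop := fun l => ∀ (r r' : Literature.NumberTheory.Transcendental.KZ.IntegralRep 3), r.domain = {p | ∀ i, p i ∈ Set.Ioo (0:ℝ) 1} → Set.EqOn r.integrand (fun p => ((1 - (l:ℝ)) * ((p 1 * (1 - p 1) * (1 - (l:ℝ) * p 1)) ^ (-(1:ℝ)/2) / 2) * ((p 2 * (1 - p 2) * (1 - (l:ℝ) * p 2)) ^ (-(1:ℝ)/2) / 2) - 2 * (l:ℝ) * (1 - (l:ℝ)) * ((((p 1 * (1 - p 1) * (1 - (l:ℝ) * p 0 * p 1)) ^ (-(1:ℝ)/2) - (p 1 * (1 - p 1) * (1 - (l:ℝ) * p 0 ^ 2 * p 1)) ^ (-(1:ℝ)/2)) / (1 - p 0)) * (p 2 * (p 2 * (1 - p 2) * (1 - (l:ℝ) * p 2)) ^ (-(1:ℝ)/2) / (4 * (1 - (l:ℝ) * p 2))) - ((p 0 * p 1 * (p 1 * (1 - p 1) *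 (1 - (l:ℝ) * p 0 * p 1)) ^ (-(1:ℝ)/2) / (2 * (1 - (l:ℝ) * p 0 * p 1)) - p 0 ^ 2 * p 1 * (p 1 * (1 - p 1) * (1 - (l:ℝ) * p 0 ^ 2 * p 1)) ^ (-(1:ℝ)/2) / (2 * (1 - (l:ℝ) * p 0 ^ 2 * p 1))) / (1 - p 0)) * ((p 2 * (1 - p 2) * (1 - (l:ℝ) * p 2)) ^ (-(1:ℝ)/2) / 2)))) r.domain → r'.domain = {p | ∀ i, p i ∈ Set.Ioo (0:ℝ) 1} → Set.EqOn r'.integrand (fun p => 4 / ((1 + p 1 ^ 2) * (1 + p 2 ^ 2))) r'.domain → Literature.NumberTheory.Transcendental.KZ.Equivalent r r'; LW 0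

/-- item stmt-KontsevichZagierPeriods-8980 · support · rank 9 · closed · proved by Summit.KontsevichZagierPeriods.GammaCornerAnomaly.legendreCornerStrata_proof @ a75ff499ab8c (prover) · by planner
sources: DupontPanzerPym2026, WhittakerWatson1927, KontsevichZagier2001
[support] the two strata of the blown-up Legendre corner, each an explicit convergent 1-dim identity
of value log 4 (their sum log 16 = κ₁ is the Dupont–Panzer–Pym stratified finite part of 2K′(λ) +
log λ at λ = 0): (i) chart λ = 0, s ∈ (0,1): [ (0,1), ((1−s)^{−1/2} − 1)/s ] ~ [ (1,4), 1/v ] (u =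
√(1−s) gives ∫₀¹2du/(1+u)); (ii) chart σ = s/λ ∈ (0,∞): [ (0,∞), (σ(1+σ))^{−1/2} − 1/(1+σ) ] ~ [
(1,4), 1/v ] (Euler substitution). Both by algebraic changes of variables + domain additivity
(LowDimension-level). [difficulty: provable-now] -/
@[route_item "route-KontsevichZagierPeriods-GammaCornerAnomaly"]
def LegendreCornerStrata : Prop :=
  (∀ (r r' : Literature.NumberTheory.Transcendental.KZ.IntegralRep 1), r.domain = {q | q 0 ∈ Set.Ioo (0:ℝ) 1} → Set.EqOn r.integrand (fun q => ((1 - q 0) ^ (-(1:ℝ)/2) - 1) / q 0) r.domain → r'.domain = {q | q 0 ∈ Set.Ioo (1:ℝ) 4} → Set.EqOn r'.integrand (fun q => 1 / q 0) r'.domain → Literature.NumberTheory.Transcendental.KZ.Equivalent r r') ∧ (∀ (r r' : Literature.NumberTheory.Transcendental.KZ.IntegralRep 1), r.domain = {q | 0 < q 0} → Set.EqOn r.integrand (fun q => (q 0 * (1 + q 0)) ^ (-(1:ℝ)/2) - 1 / (1 + q 0)) r.domain → r'.domain = {q | q 0 ∈ Set.Ioo (1:ℝ) 4} → Set.EqOn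 r'.integrand (fun q => 1 / q 0) r'.domain → Literature.NumberTheory.Transcendental.KZ.Equivalent r r')

/-- item stmt-KontsevichZagierPeriods-8981 · support · rank 9 · closed · proved by Summit.KontsevichZagierPeriods.GammaCornerAnomaly.legendreMellinMoment_proof @ 08f6a91eb05b (prover) · by planner
sources: arXiv:2206.15181, arXiv:1908.07501, KontsevichZagier2001
[support] the motivic Gamma function of the Legendre MUM point inside the rules, uniformly in the
exponent (Roy–Vlasenko's computation, arXiv:2206.15181 p. 2): for every rational s > 0, [ {0 < t < x
< 1}, t^{s−1}(x(1−x)(x−t))^{−1/2} ] (value ∫₀¹t^{s−1}·2K′(t)dt = κ(s)/s²·(normalisation)) ~ [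
(0,1)², t^{s−1}(1−t)^{−1/2}x^{s−1}(1−x)^{−1/2} ] (value B(s,½)²) by the single change of variables
(t,x) ↦ (t/x, x) (Jacobian 1/x). This is the s-uniform chain the card's E-lemma differentiates (κ₁ =
log 16 = d/ds log(s²B(s,½)²) at 0); the fibre identity K1 is its Mellin inverse. [difficulty:
provable-now] -/
@[route_item "route-KontsevichZagierPeriods-GammaCornerAnomaly"]
def LegendreMellinMoment : Prop :=
  ∀ s : ℚ, 0 < s → ∀ (r r' : Literature.NumberTheory.Transcendental.KZ.IntegralRep 2), r.domain = {q | 0 < q 0 ∧ q 0 < q 1 ∧ q 1 < 1} → Set.EqOn r.integrand (fun q => q 0 ^ ((s:ℝ) - 1) * (q 1 * (1 - q 1) * (q 1 - q 0)) ^ (-(1:ℝ)/2)) r.domain → r'.domain = {q | ∀ i, q i ∈ Set.Ioo (0:ℝ) 1} → Set.EqOn r'.integrand (fun q => q 0 ^ ((s:ℝ) - 1) * (1 - q 0) ^ (-(1:ℝ)/2) * q 1 ^ ((s:ℝ) - 1) * (1 - q 1) ^ (-(1:ℝ)/2)) r'.domain → Literature.NumberTheory.Transcendental.KZ.Equivalent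 r r'

/-- item stmt-KontsevichZagierPeriods-8982 · support · rank 9 · closed · proved by Summit.KontsevichZagierPeriods.GammaCornerAnomaly.duplicationLogDerivative_proof @ e962ffcc0d12 (prover) · by planner
sources: KontsevichZagier2001, AndrewsAskeyRoy1999, arXiv:2206.15181
[support] card P1 (E-lemma instance = weight-1 constant of Gauss duplication at s = ½): [ {0 < x < u
< 1}, (x(1−x))^{−1/2}/u ] (value ∫₀¹ log(1/x)dx/√(x(1−x)) = π log 4) ~ [ (0,1)²,
3(t(1−t))^{−1/2}/(1+3x) ] (value log 4 · π). Chain (all 2-dim, logs unfolded): symmetrise x ↔ 1−x,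
duplication change of variables t = 4x(1−x) on x < ½ (as in LowDimension 0118 / TerasomaCovering
3599) with the u-coordinate riding along, split ∫_{t/4}^1 du/u = ∫_{t/4}^t + ∫_t^1 by domain
additivity and rescale the first piece to ∫_{1/4}^1; the unknown appears on both sides with
coefficients 2 and 1, so [I] − [π log 4] ∈ relations by linear algebra in FormalRep. [difficulty:
provable-now] -/
@[route_item "route-KontsevichZagierPeriods-GammaCornerAnomaly"]
def DuplicationLogDerivative : Prop :=
  ∀ (r r' : Literature.NumberTheory.Transcendental.KZ.IntegralRep 2), r.domain = {q | 0 < q 0 ∧ q 0 < q 1 ∧ q 1 < 1} → Set.EqOn r.integrand (fun q => (q 0 * (1 - q 0)) ^ (-(1:ℝ)/2) / q 1) r.domain → r'.domain = {q | ∀ i, q i ∈ Set.Ioo (0:ℝ) 1} → Set.EqOn r'.integrand (fun q => 3 * (q 1 * (1 - q 1)) ^ (-(1:ℝ)/2) / (1 + 3 * q 0)) r'.domain → Literature.NumberTheory.Transcendental.KZ.Equivalent r r'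

/-- item stmt-KontsevichZagierPeriods-8983 · support · rank 9 · open · by planner
sources: doi:10.1112/blms/11.3.268, Apery1979, VanDerPoorten1979, arXiv:1908.07501
[support] weight-3 MUM Taylor coefficient n = 1 of the Apéry family (Apéry constant κ(1) = ζ(3)/6 of
L = θ³ − t(34θ³+51θ²+27θ+5) + t²(θ+1)³; BV Rem 32): with P = x(1−x)y(1−y)w(1−w), Q = 1 − (1−xy)w on
(0,1)³, [ (0,1)³, P/Q² ] ~ [ (0,1)³, 5/Q − 12 ] (both KZ-RATIONAL; values 2(5ζ(3) − 6) =
0.0205690316, checked). Beukers' chain is finite and rational: change of variables w ↦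
(1−w)/(1−(1−xy)w), integrations by parts with polynomial×rational primitives (Newton–Leibniz along a
coordinate, boundary terms killed by x(1−x), y(1−y)), integrand additivity, telescoping base cases
∫∫∫(x^ry^r − x^{r−1}y^{r−1})/Q = −2/r³ via u = 1−(1−xy)w and polynomial primitives. [difficulty: M] -/
@[route_item "route-KontsevichZagierPeriods-GammaCornerAnomaly"]
def AperyBeukersOne : Prop :=
  ∀ (r r' : Literature.NumberTheory.Transcendental.KZ.IntegralRep 3), r.domain = {p | ∀ i, p i ∈ Set.Ioo (0:ℝ) 1} → Set.EqOn r.integrand (fun p => (p 0 * (1 - p 0) * p 1 * (1 - p 1) * p 2 * (1 - p 2)) / (1 - (1 - p 0 * p 1) * p 2) ^ 2) r.domain → r'.domain = {p | ∀ i, p i ∈ Set.Ioo (0:ℝ) 1} → Set.EqOn r'.integrand (fun p => 5 / (1 - (1 - p 0 * p 1) * p 2) - 12) r'.domain → Literature.NumberTheory.Transcendental.KZ.Equivalent r r'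

/-- item stmt-KontsevichZagierPeriods-8984 · support · rank 9 · open · by planner
sources: doi:10.1112/blms/11.3.268, Apery1979, arXiv:1908.07501, arXiv:2008.03618
[support] the whole weight-3 MUM Taylor family: for every n, [ (0,1)³, PⁿQ^{−n−1} ] ~ [ (0,1)³, aₙ/Q
− 2bₙ ] with Apéry's aₙ = Σₖ C(n,k)²C(n+k,k)², bₙ = Σₖ C(n,k)²C(n+k,k)²(Σ_{m≤n} m⁻³ + Σ_{m≤k}
(−1)^{m−1}/(2m³C(n,m)C(n+m,m))) (values 2(aₙζ(3) − bₙ); bₙ = 0, 6, 351/4, 62531/36, … checked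
against the recurrence for n ≤ 6, integrals checked for n = 1, 2). Equivalent to "the big-disc
solution R(t) = ∫_{(0,1)³}dxdydw/(Q − tP) of L R = −12t has MUM expansion 2ζ(3)A(t) − 2B(t)"
coefficientwise; Beukers' chain uniformly in n (Rodrigues bookkeeping). [difficulty: L] -/
@[route_item "route-KontsevichZagierPeriods-GammaCornerAnomaly"]
def AperyBeukersAll : Prop :=
  ∀ (n : ℕ) (r r' : Literature.NumberTheory.Transcendental.KZ.IntegralRep 3), r.domain = {p | ∀ i, p i ∈ Set.Ioo (0:ℝ) 1} → Set.EqOn r.integrand (fun p => (p 0 * (1 - p 0) * p 1 * (1 - p 1) * p 2 * (1 - p 2)) ^ n / (1 - (1 - p 0 * p 1) * p 2) ^ (n + 1)) r.domain → r'.domain = {p | ∀ i, p i ∈ Set.Ioo (0:ℝ) 1} → Set.EqOn r'.integrand (fun p => (∑ k ∈ Finset.range (n + 1), (n.choose k : ℝ) ^ 2 * ((n + k).choose k : ℝ) ^ 2) / (1 - (1 - p 0 * p 1) * p 2) - 2 * (∑ k ∈ Finset.range (n + 1), (n.choose k : ℝ) ^ 2 * ((n + k).choose k : ℝ) ^ 2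 * ((∑ m ∈ Finset.range n, 1 / ((m:ℝ) + 1) ^ 3) + ∑ m ∈ Finset.range k, (-1:ℝ) ^ m / (2 * ((m:ℝ) + 1) ^ 3 * (n.choose (m + 1) : ℝ) * ((n + m + 1).choose (m + 1) : ℝ))))) r'.domain → Literature.NumberTheory.Transcendental.KZ.Equivalent r r'

-- earlier Assembly (stmt-KontsevichZagierPeriods-11009, replaced 2026-08-16T02:56:49Z -> stmt-KontsevichZagierPeriods-14090): retired by None — LogWronskianTransport → LogWronskianAnchor → LegendreMUMConstant → MUMSectorComplete → KontsevichZagierPeriods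
-- earlier Assembly (stmt-KontsevichZagierPeriods-8985, replaced 2026-08-15T13:59:24Z -> stmt-KontsevichZagierPeriods-9513): retired by None — LogWronskianTransport → LogWronskianAnchor → LegendreMUMConstant → (LegendreMUMConstant ∧ LegendreLogWronskian)
-- earlier Assembly (stmt-KontsevichZagierPeriods-9513, replaced 2026-08-15T16:37:15Z -> stmt-KontsevichZagierPeriods-11009): retired by None — LogWronskianTransport → LogWronskianAnchor → LegendreMUMConstant → SummitOffMUMSector → KontsevichZagierPeriods
/-- item stmt-KontsevichZagierPeriods-14090 · assembly · rank 1 · closed · proved by Summit.KontsevichZagierPeriods.GammaCornerAnomaly.assembly_proof @ 7343233001e8 (prover) · by planner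
sources: KontsevichZagier2001, arXiv:1908.07501
[assembly] LegendreMUMConstant → LegendreLogWronskian → MUMSectorComplete → KontsevichZagierPeriods:
the two sector cruxes put every adjoined MUM relator inside KZ.relations, so
AddSubgroup.closure(↑relations ∪ MUM pairs) ≤ relations and the membership given by
MUMSectorComplete is KZ.Equivalent r r′. Proved verbatim as the deciding theorem `closes` (rev 3;
axioms propext/Classical.choice/Quot.sound). The weight-2 crux's foreseen split LegendreLogWronskian
⇐ LogWronskianTransport (λ₀ = 0) + LogWronskianAnchor is support-level glue over the shared `let LW`
family (definitional). -/
@[route_item "route-KontsevichZagierPeriods-GammaCornerAnomaly"]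
def Assembly : Prop :=
  LegendreMUMConstant → LegendreLogWronskian → MUMSectorComplete → KontsevichZagierPeriods

/-! D-0027 §2.1 — DECIDING THEOREM (planner-authored via `route open/edit --closes-file`; by planner-rbadge-KontsevichZagierPeriods-GammaCo-76103480-g3-0 2026-08-16T06:10:02Z):
its hypotheses are this route's items and its conclusion the sub-problem Statement (glue_lint), and it elaborates with this file. -/

@[closes "route-KontsevichZagierPeriods-GammaCornerAnomaly"] theorem closes (hK : LegendreMUMConstant) (hW : LegendreLogWronskian) (hS : MUMSectorComplete) : KontsevichZagierPeriods := by
  intro _ _ r r' hr hr' hv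
  refine (AddSubgroup.closure_le _).mpr ?_ (hS r r' hr hr' hv)
  rintro d (hd | ⟨l, ρ, ρ', hl, hl', hd, hi, hd', hi', rfl⟩ | ⟨l, ρ, ρ', hl, hl', hd, hi, hd', hi', rfl⟩)
  · exact hd
  · exact hK l hl hl' ρ ρ' hd hi hd' hi'
  · exact hW l hl hl' ρ ρ' hd hi hd' hi'

end Summit.KontsevichZagierPeriods.KontsevichZagierPeriods.Theses.GammaCornerAnomaly
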